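import Summits.KontsevichZagierPeriods.KontsevichZagierPeriods.Theorems.RootDecompZetaThreeFrontierWordMoves

/-!
# Route A‴ `RootDecompZetaThreeFrontier` — item 32433 `GZNormalFormWThree`, registered line `gz_ladder`:
# the FOUR FACES OF `Δ₃` CANCEL (lens-1 g11 §22), part 1/4

Landing of the decomp-kz lens-1 generation-11 node (HOME/decomp-kz-lens-1/g11/WordLayer.lean §22, critic decomp-kz-crit-1 g3
CLEARED 2026-08-30T13:32:36Z: farm rc 0 / 0 warn / 0 sorry, axioms standard on `…GZLadder.stub_three_wlog`), in the form of the
lens's self-contained module `s22_scratch_WordMovesNamespace.lean` (sha256 453fc31fbca24adc…, imports ONLY the landed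
`…Theorems.RootDecompZetaThreeFrontierWordMoves`), split mechanically into ≤ 400-line parts by the census seat
(decomp-kz-census-1 g8).  Mathematics unchanged.  Part 1 = §22a–§22c: polynomial bookkeeping in `n` variables, the
positive-volume non-vanishing of a non-zero polynomial (`exists_aeval_ne_zero`), the FACE LEMMA one dimension up (`face_lemma3`)
and the generic involution transport `integrableOn_comp_invol3`.
-/

noncomputable section

set_option linter.dupNamespace false

open Set MeasureTheory MvPolynomial
open Literature.NumberTheory.Transcendental
open Literature.ModelTheory.ExponentialFields (IsSemialgebraic)

namespace Summit.KontsevichZagierPeriods.KontsevichZagierPeriods.Theorems.RootDecompZetaThreeFrontierWordMoves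

/-! ### COPIES of g10-local / private lemmas (delete at splice) -/

/-- Auxiliary step `continuous_snoc`. [bookkeeping] -/
private theorem continuous_snoc {N : ℕ} (x : Fin N → ℝ) :
    Continuous fun t : ℝ => (Fin.snoc x t : Fin (N + 1) → ℝ) := by
  refine continuous_pi fun j => ?_
  refine Fin.lastCases ?_ (fun i => ?_) j
  · simpa using continuous_id'
  · simpa using continuous_const

/-- Auxiliary step `exists_measurableEquiv_snoc`. [bookkeeping] -/
private theorem exists_measurableEquiv_snoc (N : ℕ) :
    ∃ e : (Fin (N + 1) → ℝ) ≃ᵐ (Fin N → ℝ) × ℝ,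
      MeasurePreserving e volume ((volume : Measure (Fin N → ℝ)).prod (volume : Measure ℝ)) ∧
      ∀ q, e.symm q = Fin.snoc q.1 q.2 := by
  refine ⟨(MeasurableEquiv.piFinSuccAbove (fun _ => ℝ) (Fin.last N)).trans
    MeasurableEquiv.prodComm, ?_, fun q => ?_⟩
  · refine (volume_preserving_piFinSuccAbove (fun _ => ℝ) (Fin.last N)).trans ?_
    rw [Measure.volume_eq_prod]
    exact Measure.measurePreserving_swap
  · show (MeasurableEquiv.piFinSuccAbove (fun _ => ℝ) (Fin.last N)).symm (q.2, q.1) = _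
    rw [MeasurableEquiv.piFinSuccAbove_symm_apply, Fin.insertNthEquiv_last]
    rfl

/-- Auxiliary step `ae_integrableOn_snoc`. [bookkeeping] -/
private theorem ae_integrableOn_snoc {N : ℕ} {B : Set (Fin (N + 1) → ℝ)} (hB : MeasurableSet B)
    {f : (Fin (N + 1) → ℝ) → ℝ} (hf : IntegrableOn f B) :
    ∀ᵐ x : Fin N → ℝ, IntegrableOn (fun t : ℝ => f (Fin.snoc x t))
      {t | (Fin.snoc x t : Fin (N + 1) → ℝ) ∈ B} := by
  obtain ⟨e, he, he_symm⟩ := exists_measurableEquiv_snoc N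
  have h1 : Integrable (B.indicator f) volume := (integrable_indicator_iff hB).2 hf
  have h2 : Integrable (B.indicator f ∘ e.symm) ((volume : Measure (Fin N → ℝ)).prod volume) :=
    ((he.symm e).integrable_comp_emb e.symm.measurableEmbedding).2 h1
  refine (h2.prod_right_ae).mono fun x hx => ?_
  have hm : MeasurableSet {t : ℝ | (Fin.snoc x t : Fin (N + 1) → ℝ) ∈ B} :=
    (continuous_snoc x).measurable hB
  refine (integrable_indicator_iff hm).1 (hx.congr (Filter.Eventually.of_forall fun t => ?_))
  show (B.indicator f ∘ e.symm) (x, t) = _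
  rw [Function.comp_apply, he_symm]
  exact (Set.indicator_comp_right (fun t : ℝ => (Fin.snoc x t : Fin (N + 1) → ℝ)) (g := f)).symm

/-- Auxiliary step `abs_ge_near_zero`. [bookkeeping] -/
theorem abs_ge_near_zero {M : ℝ → ℝ} (hM : ContinuousAt M 0) (h0 : M 0 ≠ 0) :
    ∃ η : ℝ, 0 < η ∧ η ≤ 1 ∧ ∀ y ∈ Ioo 0 η, |M 0| / 2 ≤ |M y| := by
  have hε : 0 < |M 0| / 2 := half_pos (abs_pos.2 h0)
  obtain ⟨δ, hδ, hδ'⟩ := Metric.continuousAt_iff.1 hM _ hε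
  refine ⟨min δ 1, lt_min hδ one_pos, min_le_right _ _, fun y hy => ?_⟩
  have hyδ : dist y 0 < δ := by
    rw [Real.dist_eq, sub_zero, abs_of_pos hy.1]
    exact hy.2.trans_le (min_le_left _ _)
  have h1 := hδ' hyδ
  rw [Real.dist_eq] at h1
  have h2 := abs_sub_abs_le_abs_sub (M 0) (M y)
  rw [abs_sub_comm] at h2
  linarith

/-- Auxiliary step `continuous_aeval_fin`. [bookkeeping] -/
theorem continuous_aeval_fin {n : ℕ} (p : MvPolynomial (Fin n) ℚ) :
    Continuous fun x : Fin n → ℝ => MvPolynomial.aeval x p := by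
  have : (fun x : Fin n → ℝ => MvPolynomial.aeval x p) =
      fun x => MvPolynomial.eval x (MvPolynomial.map (algebraMap ℚ ℝ) p) := by
    funext x; rw [MvPolynomial.eval_map, MvPolynomial.aeval_def]
  rw [this]
  exact MvPolynomial.continuous_eval _

/-- `simplex` is measurable. [bookkeeping] -/
theorem measurableSet_simplex (k : ℕ) : MeasurableSet (KZ.openOrderedSimplex k) :=
  KZ.measurableSet_openOrderedSimplex k

/-- Auxiliary step `snoc_two_zero`. [bookkeeping] -/
private theorem snoc_two_zero (x : Fin 2 → ℝ) (t : ℝ) : (Fin.snoc x t : Fin 3 → ℝ) 0 = x 0 := rfl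
/-- Auxiliary step `snoc_two_one`. [bookkeeping] -/
private theorem snoc_two_one (x : Fin 2 → ℝ) (t : ℝ) : (Fin.snoc x t : Fin 3 → ℝ) 1 = x 1 := rfl
/-- Auxiliary step `snoc_two_two`. [bookkeeping] -/
private theorem snoc_two_two (x : Fin 2 → ℝ) (t : ℝ) : (Fin.snoc x t : Fin 3 → ℝ) 2 = t := rfl

/-! ## §22  NECESSITY IN DIMENSION 3 (gen 11): the four FACES of `Δ₃` cancel — `gz_ladder.stub_three_wlog` -/

section NecessityThree

/-! ### 22a  Polynomial bookkeeping in `n` variables and the last row of a `Fin 3` polynomial -/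

/-- a polynomial all of whose monomials contain `Xᵢ^b` is `Xᵢ^b` times a polynomial (any number of variables) -/
theorem exists_X_pow_mul_fin {n : ℕ} (i : Fin n) (b : ℕ) (P : MvPolynomial (Fin n) ℚ)
    (h : ∀ e ∈ P.support, b ≤ e i) :
    ∃ P' : MvPolynomial (Fin n) ℚ, P = MvPolynomial.X i ^ b * P' := by
  refine ⟨∑ e ∈ P.support, MvPolynomial.monomial (e - Finsupp.single i b) (MvPolynomial.coeff e P), ?_⟩
  rw [Finset.mul_sum]
  conv_lhs => rw [P.as_sum]
  refine Finset.sum_congr rfl fun e he => ?_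
  rw [MvPolynomial.X_pow_eq_monomial, MvPolynomial.monomial_mul, one_mul, add_tsub_cancel_of_le]
  exact Finsupp.single_le_iff.2 (h e he)

/-- the support of `Xᵢ^b · P'` (any number of variables) -/
theorem le_of_mem_support_X_pow_mul_fin {n : ℕ} (i : Fin n) (b : ℕ) (P' : MvPolynomial (Fin n) ℚ) :
    ∀ e ∈ (MvPolynomial.X i ^ b * P').support, b ≤ e i ∧ e - Finsupp.single i b ∈ P'.support := by
  classical
  intro e he
  rw [MvPolynomial.X_pow_eq_monomial, MvPolynomial.mem_support_iff, MvPolynomial.coeff_monomial_mul'] at he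
  split_ifs at he with hle
  · rw [one_mul] at he
    exact ⟨by simpa using (hle i), MvPolynomial.mem_support_iff.2 he⟩
  · exact absurd rfl he

/-- Auxiliary step `aeval_eq_sum_three`. [bookkeeping] -/
theorem aeval_eq_sum_three (p : MvPolynomial (Fin 3) ℚ) (t : Fin 3 → ℝ) :
    MvPolynomial.aeval t p =
      ∑ m ∈ p.support, ((MvPolynomial.coeff m p : ℚ) : ℝ) * (t 0 ^ (m 0) * t 1 ^ (m 1) * t 2 ^ (m 2)) := by
  rw [MvPolynomial.aeval_def, MvPolynomial.eval₂_eq']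
  refine Finset.sum_congr rfl fun m _ => ?_
  simp [Fin.prod_univ_three, eq_ratCast]

/-- the first two exponents of a `Fin 3` exponent, as a `Fin 2` exponent -/
def init3 (e : Fin 3 →₀ ℕ) : Fin 2 →₀ ℕ := Finsupp.single 0 (e 0) + Finsupp.single 1 (e 1)

/-- Auxiliary step `init3_zero`. [bookkeeping] -/
theorem init3_zero (e : Fin 3 →₀ ℕ) : init3 e 0 = e 0 := by simp [init3]
/-- Auxiliary step `init3_one`. [bookkeeping] -/
theorem init3_one (e : Fin 3 →₀ ℕ) : init3 e 1 = e 1 := by simp [init3]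

/-- the LAST ROW `P(X₀, X₁, 0)` of `P ∈ ℚ[t₀,t₁,t₂]`, a polynomial in two variables -/
def rowLast (P : MvPolynomial (Fin 3) ℚ) : MvPolynomial (Fin 2) ℚ :=
  ∑ e ∈ P.support with e 2 = 0, MvPolynomial.monomial (init3 e) (MvPolynomial.coeff e P)

/-- Auxiliary step `aeval_rowLast`. [bookkeeping] -/
theorem aeval_rowLast (P : MvPolynomial (Fin 3) ℚ) (x : Fin 2 → ℝ) :
    MvPolynomial.aeval (Fin.snoc x (0:ℝ) : Fin 3 → ℝ) P = MvPolynomial.aeval x (rowLast P) := by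
  rw [aeval_eq_sum_three, rowLast, map_sum, Finset.sum_filter]
  refine Finset.sum_congr rfl fun e _ => ?_
  split_ifs with h
  · rw [MvPolynomial.aeval_monomial, Finsupp.prod_pow, Fin.prod_univ_two, init3_zero, init3_one, snoc_two_zero,
      snoc_two_one, snoc_two_two, h, pow_zero, mul_one, eq_ratCast]
  · rw [snoc_two_two, zero_pow h, mul_zero, mul_zero]

/-- a monomial of `P` free of `X₂` survives in the last row -/
theorem rowLast_ne_zero (P : MvPolynomial (Fin 3) ℚ) {e₀ : Fin 3 →₀ ℕ} (he₀ : e₀ ∈ P.support) (h2 : e₀ 2 = 0) :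
    rowLast P ≠ 0 := by
  classical
  intro h0
  have hc : MvPolynomial.coeff (init3 e₀) (rowLast P) = MvPolynomial.coeff e₀ P := by
    rw [rowLast, MvPolynomial.coeff_sum]
    have key : ∀ e ∈ P.support.filter (fun e : Fin 3 →₀ ℕ => e 2 = 0),
        MvPolynomial.coeff (init3 e₀) (MvPolynomial.monomial (init3 e) (MvPolynomial.coeff e P)) =
          if e = e₀ then MvPolynomial.coeff e P else 0 := by
      intro e he
      have he2 : e 2 = 0 := (Finset.mem_filter.1 he).2
      rw [MvPolynomial.coeff_monomial]
      have hiff : (init3 e = init3 e₀) ↔ e = e₀ := by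
        constructor
        · intro h
          have h0' : e 0 = e₀ 0 := by
            have := DFunLike.congr_fun h 0
            rwa [init3_zero, init3_zero] at this
          have h1' : e 1 = e₀ 1 := by
            have := DFunLike.congr_fun h 1
            rwa [init3_one, init3_one] at this
          ext j
          fin_cases j
          · exact h0'
          · exact h1'
          · show e 2 = e₀ 2
            rw [he2, h2]
        · intro h
          rw [h]
      simp only [hiff]
    rw [Finset.sum_congr rfl key, Finset.sum_ite_eq', if_pos (Finset.mem_filter.2 ⟨he₀, h2⟩)]
  rw [h0, MvPolynomial.coeff_zero] at hc
  exact (MvPolynomial.mem_support_iff.1 he₀) hc.symm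

/-! ### 22b  A non-zero polynomial is non-zero on a part of positive volume of every non-empty open set -/

/-- a polynomial over `ℚ` vanishing on a non-empty open subset of `ℝⁿ` is zero (Mathlib's `MvPolynomial.funext_set` on a box
with infinite sides inside the open set) -/
theorem exists_aeval_ne_zero {n : ℕ} {A : Set (Fin n → ℝ)} (hA : IsOpen A) (hne : A.Nonempty)
    {R : MvPolynomial (Fin n) ℚ} (hR : R ≠ 0) : ∃ x ∈ A, MvPolynomial.aeval x R ≠ 0 := by
  by_contra hcon
  push Not at hcon
  obtain ⟨x₀, hx₀⟩ := hne
  obtain ⟨δ, hδ, hball⟩ := Metric.isOpen_iff.1 hA x₀ hx₀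
  apply hR
  have hmap : MvPolynomial.map (algebraMap ℚ ℝ) R = 0 := by
    refine MvPolynomial.funext_set (fun i => Ioo (x₀ i - δ) (x₀ i + δ))
      (fun i => Set.Ioo_infinite (by linarith)) fun x hx => ?_
    rw [map_zero]
    have hxA : x ∈ A := by
      refine hball ?_
      rw [Metric.mem_ball, dist_pi_lt_iff hδ]
      intro i
      have hi := hx i (mem_univ i)
      rw [Real.dist_eq, abs_sub_lt_iff]
      constructor <;> linarith [hi.1, hi.2]
    rw [MvPolynomial.eval_map, ← MvPolynomial.aeval_def]
    exact hcon x hxA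
  exact MvPolynomial.map_injective (algebraMap ℚ ℝ) (algebraMap ℚ ℝ).injective (by rw [hmap, map_zero])

/-- … hence it is non-zero on an open part of positive volume -/
theorem volume_aeval_ne_zero {n : ℕ} {A : Set (Fin n → ℝ)} (hA : IsOpen A) (hne : A.Nonempty)
    {R : MvPolynomial (Fin n) ℚ} (hR : R ≠ 0) :
    volume (A ∩ {x | MvPolynomial.aeval x R ≠ 0}) ≠ 0 := by
  have hopen : IsOpen (A ∩ {x : Fin n → ℝ | MvPolynomial.aeval x R ≠ 0}) :=
    hA.inter (isOpen_ne_fun (continuous_aeval_fin R) continuous_const)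
  obtain ⟨x, hx, hxR⟩ := exists_aeval_ne_zero hA hne hR
  exact hopen.measure_ne_zero volume ⟨x, hx, hxR⟩

/-! ### 22c  THE FACE LEMMA IN DIMENSION 3 -/

/-- **FACE LEMMA (dimension 3).**  `B ⊆ ℝ³` is a measurable cell whose last-coordinate sections over a non-empty open base
`A ⊆ ℝ²` are the intervals `(0, ℓ(x))`, `0 < ℓ ≤ 1`; `D` is non-zero on `B` and, along each section, continuous and non-zero at
the face `y₂ = 0`.  If `P(y)/(y₂^b · D(y))` is integrable on `B` then every monomial of `P` contains `y₂^b`.  (Fubini a.e. sections;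
the row `P(·,·,0)` is a non-zero polynomial in two variables, hence non-zero on an open part of `A` of positive volume (§22b); there each
section carries a pole of order `≥ 1` — the pole test of §12a.) -/
theorem face_lemma3 {B : Set (Fin 3 → ℝ)} (hB : MeasurableSet B) (hB2 : ∀ y ∈ B, y 2 ≠ 0)
    {A : Set (Fin 2 → ℝ)} (hA : IsOpen A) (hAne : A.Nonempty) (ℓ : (Fin 2 → ℝ) → ℝ)
    (hsec : ∀ x ∈ A, {t : ℝ | (Fin.snoc x t : Fin 3 → ℝ) ∈ B} = Ioo 0 (ℓ x))
    (hℓ : ∀ x ∈ A, 0 < ℓ x ∧ ℓ x ≤ 1) (D : (Fin 3 → ℝ) → ℝ)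
    (hDc : ∀ x ∈ A, ContinuousAt (fun s : ℝ => D (Fin.snoc x s)) 0)
    (hD0 : ∀ x ∈ A, D (Fin.snoc x (0:ℝ)) ≠ 0) :
    ∀ (b : ℕ) (P : MvPolynomial (Fin 3) ℚ),
      IntegrableOn (fun y => MvPolynomial.aeval y P / (y 2 ^ b * D y)) B → ∀ e ∈ P.support, b ≤ e 2 := by
  intro b
  induction b with
  | zero => exact fun P _ e _ => Nat.zero_le _
  | succ b ih =>
    intro P hP
    -- (1) every monomial of `P` contains `y₂`
    have hrow : ∀ e ∈ P.support, 1 ≤ e 2 := by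
      by_contra hne
      push Not at hne
      obtain ⟨e₀, he₀, he₀2⟩ := hne
      have hR : rowLast P ≠ 0 := rowLast_ne_zero P he₀ (Nat.lt_one_iff.1 he₀2)
      have hae := ae_integrableOn_snoc hB hP
      refine false_of_ae_of_forall_not hae (S := A ∩ {x | MvPolynomial.aeval x (rowLast P) ≠ 0})
        (fun x hx h => ?_) (volume_aeval_ne_zero hA hAne hR)
      obtain ⟨hxA, hxR⟩ := hx
      rw [hsec x hxA] at h
      have hMc : ContinuousAt
          (fun t : ℝ => MvPolynomial.aeval (Fin.snoc x t : Fin 3 → ℝ) P / D (Fin.snoc x t)) 0 :=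
        ((continuous_aeval_fin P).comp (continuous_snoc x)).continuousAt.div₀ (hDc x hxA) (hD0 x hxA)
      have hM0 : (fun t : ℝ => MvPolynomial.aeval (Fin.snoc x t : Fin 3 → ℝ) P / D (Fin.snoc x t)) 0 ≠ 0 := by
        refine div_ne_zero ?_ (hD0 x hxA)
        rw [aeval_rowLast]
        exact hxR
      obtain ⟨η, hη, hη1, hMη⟩ := abs_ge_near_zero hMc hM0
      have hη' : 0 < min η (ℓ x) := lt_min hη (hℓ x hxA).1
      refine not_integrableOn_pole (half_pos (abs_pos.2 hM0)) hη' ((min_le_left _ _).trans hη1)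
        (Nat.succ_le_succ b.zero_le) (fun y hy => hMη y ⟨hy.1, hy.2.trans_le (min_le_left _ _)⟩)
        ((h.mono_set (Ioo_subset_Ioo_right (min_le_right _ _))).congr_fun (fun t _ => ?_) measurableSet_Ioo)
      show MvPolynomial.aeval (Fin.snoc x t : Fin 3 → ℝ) P /
          ((Fin.snoc x t : Fin 3 → ℝ) 2 ^ (b + 1) * D (Fin.snoc x t)) =
        MvPolynomial.aeval (Fin.snoc x t : Fin 3 → ℝ) P / D (Fin.snoc x t) / t ^ (b + 1)
      rw [div_div, mul_comm (D _)]
      rfl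
    -- (2) cancel one factor `y₂` and recurse
    obtain ⟨P', rfl⟩ := exists_X_pow_mul_fin 2 1 P hrow
    have hP' : IntegrableOn (fun y => MvPolynomial.aeval y P' / (y 2 ^ b * D y)) B := by
      refine hP.congr_fun (fun y hy => ?_) hB
      show MvPolynomial.aeval y (MvPolynomial.X 2 ^ 1 * P') / (y 2 ^ (b + 1) * D y) =
        MvPolynomial.aeval y P' / (y 2 ^ b * D y)
      rw [map_mul, map_pow, MvPolynomial.aeval_X, pow_one, pow_succ', mul_assoc, mul_div_mul_left _ _ (hB2 y hy)]
    have ih' := ih P' hP'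
    intro e he
    obtain ⟨h1, he'⟩ := le_of_mem_support_X_pow_mul_fin 2 1 P' e he
    have := ih' _ he'
    simp only [Finsupp.coe_tsub, Pi.sub_apply, Finsupp.single_eq_same] at this
    omega

/-! ### 22d  Transport of integrability by the linear involutions of `Δ₃` -/

/-- a `C¹` involution `Φ` of `Δ₃` with constant derivative of `|det| = 1` transports integrability: `F ∘ Φ` is integrable on `Δ₃` -/
theorem integrableOn_comp_invol3 {Φ : (Fin 3 → ℝ) → (Fin 3 → ℝ)} {L : (Fin 3 → ℝ) →L[ℝ] (Fin 3 → ℝ)}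
    (hd : ∀ x, HasFDerivAt Φ L x) (hL : |L.det| = 1) (hinv : ∀ z, Φ (Φ z) = z)
    (hmem : ∀ z ∈ KZ.openOrderedSimplex 3, Φ z ∈ KZ.openOrderedSimplex 3)
    {F : (Fin 3 → ℝ) → ℝ} (hF : IntegrableOn F (KZ.openOrderedSimplex 3)) :
    IntegrableOn (fun z => F (Φ z)) (KZ.openOrderedSimplex 3) := by
  have hm := measurableSet_simplex 3
  have himage : Φ '' KZ.openOrderedSimplex 3 = KZ.openOrderedSimplex 3 := by
    ext u
    constructor
    · rintro ⟨z, hz, rfl⟩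
      exact hmem z hz
    · intro hu
      exact ⟨Φ u, hmem u hu, hinv u⟩
  have key := (integrableOn_image_iff_integrableOn_abs_det_fderiv_smul (μ := volume) hm
    (fun x _ => (hd x).hasFDerivWithinAt) (fun a _ b _ h => by
      have := congrArg Φ h
      rwa [hinv, hinv] at this) (fun z => F (Φ z))).2
    (hF.congr_fun (fun p _ => by simp [hL, hinv]) hm)
  rwa [himage] at key

/-- `|det L| = 1` for a linear involution -/
theorem abs_det_of_invol {L : (Fin 3 → ℝ) →L[ℝ] (Fin 3 → ℝ)} (h : ∀ w, L (L w) = w) : |L.det| = 1 := by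
  have hcomp : (L : (Fin 3 → ℝ) →ₗ[ℝ] (Fin 3 → ℝ)) ∘ₗ (L : (Fin 3 → ℝ) →ₗ[ℝ] (Fin 3 → ℝ)) = LinearMap.id := by
    apply LinearMap.ext
    intro w
    simp [h]
  have h1 := congrArg LinearMap.det hcomp
  rw [LinearMap.det_comp, LinearMap.det_id] at h1
  have h2 : |LinearMap.det (L : (Fin 3 → ℝ) →ₗ[ℝ] (Fin 3 → ℝ))| ^ 2 = 1 := by
    rw [sq_abs, sq, h1]
  exact (pow_eq_one_iff_of_nonneg (abs_nonneg _) two_ne_zero).1 h2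

end NecessityThree

end Summit.KontsevichZagierPeriods.KontsevichZagierPeriods.Theorems.RootDecompZetaThreeFrontierWordMoves
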